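import Summits.CriticalPhenomena.PercolationContinuityZ3.Theorems.PercAnnulusCrossingIICWindowDecoupling
import HarnessLib

/-!
# On a far window the IIC has density `1 ± C·π(‖x‖)/π(m)` with respect to `P_{p_c}` (lane RSW3, p1 gen 23)

builds on p205010 (kernel theorem, internal audit signed; external expert review pending) — NOT used in this file (only `p_c(ℤ^d) > 0`;
hypothesis (A2)□ through one-arm quasi-multiplicativity and the ratio bound).

RSW3 lane (LANE 3 `prim-rsw3`), seat `prim-rsw3-p1` (gen 23).  Helper file (`--supports stmt-CriticalPhenomena-4575`); no definitions,
no sorries.  Memo `run/shared/lean/prim/rsw3/P1-QM.md` §36.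

From `…IICWindowDecoupling` (`|P(E ∩ A_N) − P(E)π(N)| ≤ P(E)·P(H)·P(T₁)·P(T₂)`) with `R₁ = ‖x‖ = n`, `R₂ = 2n + 1`:
`P(H) ≤ π(n − m) ≤ B·π(n)` (head), `P(T₁) ≤ π(n)/(c·π(m))` (translated annulus crossing, quasi-multiplicativity),
`P(T₂) ≤ π(N)/(c·π(2n+2)) ≤ B·π(N)/(c·π(n))` (tail), and `N → ∞` along the cylinder `E`:

* **`exists_iicMeasure_abs_real_sub_le_mul_real_criticalProbI`** — at `p_c(ℤ^d)`, `d ≥ 2`, under (A2)□(s,L): there is `C > 0` such that for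
  every IIC probability measure `ν`, every `m ≥ 1`, every `x` with `2m ≤ ‖x‖_∞` and every event `E` determined by pairs inside `Λ_x(m)`:
  **`|ν(E) − P_{p_c}(E)| ≤ C·(π_{p_c}(‖x‖)/π_{p_c}(m))·P_{p_c}(E)`** — THE RADON–NIKODYM DENSITY OF THE IIC MEASURE ON THE σ-ALGEBRA OF A FAR
  WINDOW IS `1 ± C·π(‖x‖)/π(m)`: the definitive quantitative form of Kesten's local limit (his Theorem (3)), uniform over all window events
  however unlikely; the additive form `…IICLocalLimitSharp` and the mixing bound `…IICWindowMixing` follow with `P(E) ≤ 1`.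
LANE-4 (O27): in arm-conditioned samples, EVERY window statistic at distance `n`, radius `m`, has relative bias `≤ C·π̂(n)/π̂(m)`.
References: H. Kesten, PTRF 73 (1986) Thm. (3), (8); D. Basu, A. Sapozhnikov, ECP 22 (2017) §1 (A2).
-/

noncomputable section

namespace Summit.CriticalPhenomena.PercolationContinuityZ3.Theorems.Crossing

open MeasureTheory Filter Topology Literature.Probability.Percolation Literature.Probability.LatticeModels
open Literature.Probability.Percolation.DCT16
open Summit.CriticalPhenomena.PercolationContinuityZ3.Theorems.SurfaceTension
open scoped Literature.Probability.Percolation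

variable {d : ℕ}

open Classical in
/-- **ON A FAR WINDOW THE IIC HAS DENSITY `1 ± C·π(‖x‖)/π(m)` WITH RESPECT TO `P_{p_c}`** (`p_c(ℤ^d)`, `d ≥ 2`; (A2)□ at aspect `(s,L)`,
`2 ≤ s ≤ L`, `ϰ > 0`): there is `C > 0` such that for every IIC probability measure `ν`, every `m ≥ 1`, every `x` with `2m ≤ ‖x‖_∞`, every finite
set `F` of pairs with all members in `Λ_x(m)` and every event `E` determined by `F`:
**`|ν(E) − P_{p_c}(E)| ≤ C·(π_{p_c}(‖x‖)/π_{p_c}(m))·P_{p_c}(E)`** (§2 with `R₁ = ‖x‖`, `R₂ = 2‖x‖ + 1`; `P(H) ≤ π(‖x‖ − m) ≤ Bπ(‖x‖)`,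
`P(T₁) ≤ π(‖x‖)/(cπ(m))`, `P(T₂) ≤ π(N)/(cπ(2‖x‖+2)) ≤ Bπ(N)/(cπ(‖x‖))`; `N → ∞`). [cite: Kesten1986, Thm. (3), (8)]
[cite: BasuSapozhnikov2017ECP, §1 (A2)] -/
theorem exists_iicMeasure_abs_real_sub_le_mul_real_criticalProbI (hd : 2 ≤ d) {s L : ℕ} (hs : 2 ≤ s) (hsL : s ≤ L)
    {ϰ : ℝ} (hϰ : 0 < ϰ) (hA2 : SetToSetQuasiMultAspectAt d (criticalProbI d) s L ϰ) :
    ∃ C : ℝ, 0 < C ∧ ∀ (ν : Measure (BondConfig (Site d))) [IsProbabilityMeasure ν],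
      (∀ (F : Finset (Sym2 (Site d))) (E : Set (BondConfig (Site d))), MeasurableSet E → DeterminedBy E ↑F →
        Tendsto (fun n : ℕ => (bondPercolation (zdGraph d) (criticalProbI d)).real (E ∩ siteToBoundary d n) /
          oneArmProb d (criticalProbI d) n) atTop (𝓝 (ν.real E))) →
      ∀ (m : ℕ) (x : Site d) (F : Finset (Sym2 (Site d))) (E : Set (BondConfig (Site d))),
        1 ≤ m → 2 * m ≤ Site.supNorm x → (∀ e ∈ F, ∀ u ∈ e, u ∈ (box d m).image (· + x)) → DeterminedBy E (↑F : Set (Sym2 (Site d))) →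
        |ν.real E - (bondPercolation (zdGraph d) (criticalProbI d)).real E| ≤
          C * (oneArmProb d (criticalProbI d) (Site.supNorm x) / oneArmProb d (criticalProbI d) m) *
            (bondPercolation (zdGraph d) (criticalProbI d)).real E := by
  have hd1 : 1 ≤ d := le_trans (by norm_num) hd
  have hp : 0 < ((criticalProbI d : unitInterval) : ℝ) := by
    rw [coe_criticalProbI]; exact criticalProb_zd_pos d hd1
  have hπ : ∀ m : ℕ, 0 < oneArmProb d (criticalProbI d) m := fun m => oneArmProb_pos hd1 _ hp m
  obtain ⟨cq, hcq, hQM⟩ := oneArmQuasiMultAt_of_setToSetQuasiMultAspectAt hd hs hsL hϰ hA2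
  obtain ⟨B, hB, hR⟩ := Rsw3.exists_oneArmProb_ratio_of_setToSetQuasiMultAspectAt hd hs hsL hϰ hA2
  refine ⟨B * B / (cq * cq), div_pos (mul_pos hB hB) (mul_pos hcq hcq), fun ν _ hν m x F E hm h2m hF hE => ?_⟩
  set μ := bondPercolation (zdGraph d) (criticalProbI d) with hμ
  set n := Site.supNorm x with hn
  have hn1 : 1 ≤ n := by omega
  have hmn : m ≤ n := by omega
  -- geometric hypotheses of §1 with `R₁ = n`, `R₂ = 2n + 1`
  have h0 : (0 : Site d) ∉ (box d m).image (· + x) := by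
    intro h0
    obtain ⟨c, hc, hc0⟩ := Finset.mem_image.1 h0
    have hcm := mem_box_iff_supNorm_le.1 hc
    have : x = -c := by rw [← sub_eq_zero, sub_neg_eq_add, add_comm]; exact hc0
    rw [this, Site.supNorm_neg] at hn
    omega
  have hR₂ : ∀ u ∈ (box d n).image (· + x), u ∈ box d (2 * n + 1 - 1) := by
    intro u hu
    obtain ⟨c, hc, rfl⟩ := Finset.mem_image.1 hu
    have hcn := mem_box_iff_supNorm_le.1 hc
    have := Site.supNorm_add_le c x
    exact mem_box_iff_supNorm_le.2 (by omega)
  -- the pieces' probabilities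
  have hH : ∀ N : ℕ, μ.real {ω : BondConfig (Site d) | ∃ w ∈ (box d m).image (· + x),
      ω ∈ openConnIn (↑(box d N) : Set (Site d)) (0 : Site d) w} ≤ B * oneArmProb d (criticalProbI d) n := by
    intro N
    have h1 : μ.real {ω : BondConfig (Site d) | ∃ w ∈ (box d m).image (· + x), ω ∈ openConnIn (↑(box d N) : Set (Site d)) (0 : Site d) w} ≤
        oneArmProb d (criticalProbI d) (n - m) := by
      refine real_mono_of_forall_subset_edgeSet (zdGraph d) _ fun ω hω ⟨w, hw, h0w⟩ => ?_
      obtain ⟨c, hc, rfl⟩ := Finset.mem_image.1 hw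
      have hcm := mem_box_iff_supNorm_le.1 hc
      have hcx : n ≤ Site.supNorm (c + x) + Site.supNorm c := by
        have h := Site.supNorm_add_le (c + x) (-c)
        rwa [Site.supNorm_neg, add_neg_cancel_comm] at h
      refine siteToBoundary_of_openConnIn_of_notMem (by omega) hω (fun h' => ?_) h0w
      have := mem_box_iff_supNorm_le.1 h'; omega
    exact h1.trans (hR _ _ (by omega) (by omega) (by omega))
  have hT₁ : μ.real {ω : BondConfig (Site d) | ∃ q ∈ (box d m).image (· + x), ∃ s ∈ (innerBoundary (zdGraph d) (box d n)).image (· + x),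
      ω ∈ openConnIn (↑((box d n).image (· + x)) : Set (Site d)) q s} ≤ oneArmProb d (criticalProbI d) n / (cq * oneArmProb d (criticalProbI d) m) := by
    rw [real_ballCrossing_eq, le_div_iff₀ (mul_pos hcq (hπ m))]
    have h1 := real_mono_of_forall_subset_edgeSet (zdGraph d) (criticalProbI d) fun ω hω h => link_subset_boxCrossing (R₀ := m) (R₁ := n) hω h
    have h2 := hQM m n hm hmn
    calc μ.real {ω : BondConfig (Site d) | ∃ q ∈ box d m, ∃ t ∈ innerBoundary (zdGraph d) (box d n),
          ω ∈ openConnIn (↑(box d n) : Set (Site d)) q t} * (cq * oneArmProb d (criticalProbI d) m)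
        = cq * (oneArmProb d (criticalProbI d) m * μ.real {ω : BondConfig (Site d) | ∃ q ∈ box d m, ∃ t ∈ innerBoundary (zdGraph d) (box d n),
          ω ∈ openConnIn (↑(box d n) : Set (Site d)) q t}) := by ring
      _ ≤ cq * (oneArmProb d (criticalProbI d) m * μ.real (boxCrossing d m n)) :=
          mul_le_mul_of_nonneg_left (mul_le_mul_of_nonneg_left h1 (hπ m).le) hcq.le
      _ ≤ oneArmProb d (criticalProbI d) n := h2
  have hT₂ : ∀ N : ℕ, 2 * n + 2 ≤ N → μ.real {ω : BondConfig (Site d) | ∃ s ∈ innerBoundary (zdGraph d) (box d (2 * n + 1 + 1)),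
      ∃ t ∈ innerBoundary (zdGraph d) (box d N), ω ∈ openConnIn ((↑(box d N) : Set (Site d)) \ ↑(box d (2 * n + 1))) s t} ≤
      B * oneArmProb d (criticalProbI d) N / (cq * oneArmProb d (criticalProbI d) n) := by
    intro N hN
    have hT : μ.real {ω : BondConfig (Site d) | ∃ s ∈ innerBoundary (zdGraph d) (box d (2 * n + 1 + 1)),
        ∃ t ∈ innerBoundary (zdGraph d) (box d N), ω ∈ openConnIn ((↑(box d N) : Set (Site d)) \ ↑(box d (2 * n + 1))) s t} ≤
        μ.real (boxCrossing d (2 * n + 1 + 1) N) := by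
      rw [← real_cross_eq_real_boxCrossing (criticalProbI d) (by omega : 2 * n + 1 + 1 ≤ N)]
      refine measureReal_mono (fun ω hω => ?_) (measure_ne_top _ _)
      obtain ⟨u, hu, t, ht, hut⟩ := hω
      exact ⟨u, (mem_innerBoundary_iff.1 hu).1, t, ht, openConnIn_mono (fun x hx => hx.1) _ _ hut⟩
    have hqm := hQM (2 * n + 1 + 1) N (by omega) (by omega)
    have hratio : oneArmProb d (criticalProbI d) n ≤ B * oneArmProb d (criticalProbI d) (2 * n + 1 + 1) := hR n _ hn1 (by omega) (by omega)
    rw [le_div_iff₀ (mul_pos hcq (hπ n))]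
    calc μ.real {ω : BondConfig (Site d) | ∃ s ∈ innerBoundary (zdGraph d) (box d (2 * n + 1 + 1)),
          ∃ t ∈ innerBoundary (zdGraph d) (box d N), ω ∈ openConnIn ((↑(box d N) : Set (Site d)) \ ↑(box d (2 * n + 1))) s t} *
          (cq * oneArmProb d (criticalProbI d) n)
        ≤ μ.real (boxCrossing d (2 * n + 1 + 1) N) * (cq * (B * oneArmProb d (criticalProbI d) (2 * n + 1 + 1))) :=
          mul_le_mul hT (mul_le_mul_of_nonneg_left hratio hcq.le) (mul_nonneg hcq.le (hπ n).le) measureReal_nonneg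
      _ = B * (cq * (oneArmProb d (criticalProbI d) (2 * n + 1 + 1) * μ.real (boxCrossing d (2 * n + 1 + 1) N))) := by ring
      _ ≤ B * oneArmProb d (criticalProbI d) N := mul_le_mul_of_nonneg_left hqm hB.le
  -- the finite-volume bound, divided by `π(N)`
  have hfin : ∀ N : ℕ, 2 * n + 2 ≤ N →
      |μ.real (E ∩ siteToBoundary d N) / oneArmProb d (criticalProbI d) N - μ.real E| ≤
        B * B / (cq * cq) * (oneArmProb d (criticalProbI d) n / oneArmProb d (criticalProbI d) m) * μ.real E := by
    intro N hN
    have hπN := hπ N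
    have h := abs_real_inter_siteToBoundary_sub_mul_le_mul_of_window (criticalProbI d) F hF h0 hmn hR₂ (by omega) (by omega : 2 * n + 1 < N) hE
    have hprod : μ.real {ω : BondConfig (Site d) | ∃ w ∈ (box d m).image (· + x), ω ∈ openConnIn (↑(box d N) : Set (Site d)) (0 : Site d) w} *
        (μ.real {ω : BondConfig (Site d) | ∃ q ∈ (box d m).image (· + x), ∃ s ∈ (innerBoundary (zdGraph d) (box d n)).image (· + x),
          ω ∈ openConnIn (↑((box d n).image (· + x)) : Set (Site d)) q s} *
        μ.real {ω : BondConfig (Site d) | ∃ s ∈ innerBoundary (zdGraph d) (box d (2 * n + 1 + 1)),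
          ∃ t ∈ innerBoundary (zdGraph d) (box d N), ω ∈ openConnIn ((↑(box d N) : Set (Site d)) \ ↑(box d (2 * n + 1))) s t}) ≤
        (B * oneArmProb d (criticalProbI d) n) * ((oneArmProb d (criticalProbI d) n / (cq * oneArmProb d (criticalProbI d) m)) *
          (B * oneArmProb d (criticalProbI d) N / (cq * oneArmProb d (criticalProbI d) n))) :=
      mul_le_mul (hH N) (mul_le_mul hT₁ (hT₂ N hN) measureReal_nonneg
          (div_nonneg (hπ n).le (mul_nonneg hcq.le (hπ m).le))) (mul_nonneg measureReal_nonneg measureReal_nonneg)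
        (mul_nonneg hB.le (hπ n).le)
    have heq : (B * oneArmProb d (criticalProbI d) n) * ((oneArmProb d (criticalProbI d) n / (cq * oneArmProb d (criticalProbI d) m)) *
          (B * oneArmProb d (criticalProbI d) N / (cq * oneArmProb d (criticalProbI d) n))) =
        B * B / (cq * cq) * (oneArmProb d (criticalProbI d) n / oneArmProb d (criticalProbI d) m) * oneArmProb d (criticalProbI d) N := by
      have := (hπ n).ne'; have := (hπ m).ne'; field_simp
    have h2 : |μ.real (E ∩ siteToBoundary d N) - μ.real E * oneArmProb d (criticalProbI d) N| ≤
        μ.real E * (B * B / (cq * cq) * (oneArmProb d (criticalProbI d) n / oneArmProb d (criticalProbI d) m) * oneArmProb d (criticalProbI d) N) :=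
      h.trans (by rw [← heq]; exact mul_le_mul_of_nonneg_left hprod measureReal_nonneg)
    have hrew : μ.real (E ∩ siteToBoundary d N) / oneArmProb d (criticalProbI d) N - μ.real E =
        (μ.real (E ∩ siteToBoundary d N) - μ.real E * oneArmProb d (criticalProbI d) N) / oneArmProb d (criticalProbI d) N := by
      field_simp
    rw [hrew, abs_div, abs_of_pos hπN, div_le_iff₀ hπN]
    calc |μ.real (E ∩ siteToBoundary d N) - μ.real E * oneArmProb d (criticalProbI d) N|
        ≤ μ.real E * (B * B / (cq * cq) * (oneArmProb d (criticalProbI d) n / oneArmProb d (criticalProbI d) m) * oneArmProb d (criticalProbI d) N) := h2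
      _ = B * B / (cq * cq) * (oneArmProb d (criticalProbI d) n / oneArmProb d (criticalProbI d) m) * μ.real E * oneArmProb d (criticalProbI d) N := by
          ring
  -- `N → ∞`
  have hlim := ((tendsto_iicMeasure_of_isLocalEvent (criticalProbI d) hν ⟨F, hE⟩).sub_const (μ.real E)).abs
  exact le_of_tendsto hlim (eventually_atTop.2 ⟨2 * n + 2, fun N hN => hfin N hN⟩)

end Summit.CriticalPhenomena.PercolationContinuityZ3.Theorems.Crossing

end
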